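import Summits.CriticalPhenomena.PercolationContinuityZ3.Theorems.FK.PressureConvexity
import HarnessLib

/-!
# LARGE DEVIATIONS OF THE NUMBER OF CLUSTERS OF THE RANDOM-CLUSTER MODEL, I: THE MEASURES `φ^B_{G,p,q}` AT FIXED `p` ARE AN
# EXPONENTIAL FAMILY IN `κ = log q` WITH NATURAL STATISTIC THE CLUSTER COUNT `k^B(ω)`; MOMENT GENERATING FUNCTION, TANGENT BOUNDS,
# CHERNOFF BOUNDS (any finite graph, any wired set, every `q, q' > 0`; Grimmett 2006 §4.5 Thm. (4.58), (4.80)–(4.84); Ellis 2006 Thm. II.6.1)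

Claimed R42 (8)(c) in the cell INBOX at 2026-08-29T14:03:36Z by fkp-10a gen 360 (NEW CLAIM #7 of the gen), addressed to coordinator fk-4 gen 299 (seated 12:03Z 2026-08-29; R182–R186 in force; rulings R187 (claim #6) / R188 requested); lineage row FO-10a-g360k (self-suggested), package g360-clusterld, label CL-A.
Helper file of the `fk-continuity` build cell (bschramm lane; `--supports stmt-CriticalPhenomena-4575`; fkp-10a gen 360,
package g360-clusterld, label CL-A); builds on p205010 (kernel theorem, internal audit signed; external expert review
pending). No definitions, no named facts, no sorries; standard axioms.
UNCONDITIONAL (random-cluster measure `φ^B_{G,p,q}` of ANY finite simple graph `G` with ANY wired vertex set `B`, `0 < p < 1`,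
cluster-weights `q, q' > 0`; `k^B(ω) = clusterCount ω B`, `Z(q) = Z^B_{G,p,q}`).
Scope: finite-volume identities and inequalities for the law of `k^B(ω)` (no infinite-volume statement, no `p_c`, nothing about
FH / TP_FK); nothing percolation-bearing beyond the finite volume.

With `s = log(q'/q)`:

* **`rcExpect_exp_mul_clusterCount`** — THE MOMENT GENERATING FUNCTION `E^B_{G,p,q} e^{s k^B(ω)} = Z(q')/Z(q)`
  (`rcWeight_eq_mul_ratio₂` with `p₂ = p₁`): at fixed `p` the random-cluster measures are an exponential family in `log q` with
  natural statistic the cluster count and cumulant generating function the increment of the convex `κ ↦ log Z(p, e^κ)`;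
  `log_rcExpect_exp_mul_clusterCount`;
* `mul_rcExpect_clusterCount_le_sub` / `sub_le_mul_rcExpect_clusterCount` — TANGENT BOUNDS
  `s E_q k ≤ log Z(q') − log Z(q) ≤ s E_{q'} k`;
* **`rcExpect_indicator_le_clusterCount_le`** / `rcExpect_indicator_clusterCount_le_le` — CHERNOFF BOUNDS
  `φ_q{a ≤ k} ≤ exp(−(sa − (log Z(q') − log Z(q))))` for `q ≤ q'`, `φ_q{k ≤ a} ≤ exp(−(sa − (log Z(q') − log Z(q))))` for `q' ≤ q`;
  mean forms `…_mean`; measure forms `rcMeasure_real_le_clusterCount_le` / `rcMeasure_real_clusterCount_le_le`.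

The sequel `ClusterCountLargeDeviations` passes to `ℤ^d` boxes: LD upper bounds with the `q`-pressure and the exponential absence of
cluster densities above `κ⁰(p,q)` / below `κ¹(p,q)`.

## References

* G. Grimmett, *The Random-Cluster Model*, Springer (2006), §1.2 eq. (1.2), §3.6, §4.5 Thm. (4.58), (4.80)–(4.84) (the pressure as a
  convex function of `log q`, its derivative the cluster density). [Grimmett2006]
* R. S. Ellis, *Entropy, Large Deviations, and Statistical Mechanics*, Springer (2006), Thm. II.6.1, §VII.3. [Ellis2006]
-/

noncomputable section

namespace Summit.CriticalPhenomena.PercolationContinuityZ3.Theorems.FK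

namespace RandomClusterLargeDeviations

open Finset Set
open Literature.Probability.LatticeModels Literature.Probability.Percolation

variable {V : Type*} [Fintype V] [DecidableEq V] (G : SimpleGraph V) [DecidableRel G.Adj]

/-! ### The `q`-tilt multiplies the weight of `ω` by `e^{s k^B(ω)}` -/

/-- **THE MOMENT GENERATING FUNCTION OF THE CLUSTER COUNT**: for `0 < p < 1`, `q, q' > 0`, any wired set `B`:
`E^B_{G,p,q} e^{log(q'/q) k^B(ω)} = Z^B_{G,p,q'}/Z^B_{G,p,q}`. [cite: Grimmett2006, §4.5 Thm. (4.58), (4.80); Ellis2006, §VII.3] -/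
theorem rcExpect_exp_mul_clusterCount {p q q' : ℝ} (hp : p ∈ Set.Ioo (0 : ℝ) 1) (hq : 0 < q) (hq' : 0 < q') (B : Set V) :
    rcExpect G p q B (fun ω => Real.exp (Real.log (q' / q) * clusterCount (↑ω : BondConfig V) B)) =
      rcPartitionFunction G p q' B / rcPartitionFunction G p q B := by
  have hpI : p ∈ Set.Icc (0 : ℝ) 1 := ⟨hp.1.le, hp.2.le⟩
  rw [rcExpect, rcPartitionFunction, rcPartitionFunction, Finset.sum_div]
  refine Finset.sum_congr rfl fun ω _ => ?_
  rw [rcWeight_eq_mul_ratio₂ G hp hq p q' B ω, div_self hp.1.ne', div_self (sub_pos.2 hp.2).ne', one_pow, one_pow, one_mul,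
    one_mul, ← Real.exp_log (pow_pos (div_pos hq' hq) (clusterCount (↑ω : BondConfig V) B)), Real.log_pow, mul_div_right_comm,
    mul_comm (Real.log (q' / q))]

/-- `log E_q e^{s k} = log Z(q') − log Z(q)` (`s = log(q'/q)`). [cite: Grimmett2006, §4.5 Thm. (4.58); Ellis2006, (2.28)] -/
theorem log_rcExpect_exp_mul_clusterCount {p q q' : ℝ} (hp : p ∈ Set.Ioo (0 : ℝ) 1) (hq : 0 < q) (hq' : 0 < q') (B : Set V) :
    Real.log (rcExpect G p q B (fun ω => Real.exp (Real.log (q' / q) * clusterCount (↑ω : BondConfig V) B))) =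
      Real.log (rcPartitionFunction G p q' B) - Real.log (rcPartitionFunction G p q B) := by
  have hpI : p ∈ Set.Icc (0 : ℝ) 1 := ⟨hp.1.le, hp.2.le⟩
  rw [rcExpect_exp_mul_clusterCount G hp hq hq' B,
    Real.log_div (rcPartitionFunction_pos G hpI hq' B).ne' (rcPartitionFunction_pos G hpI hq B).ne']

/-! ### Tangent bounds: `s E_q k ≤ log Z(q') − log Z(q) ≤ s E_{q'} k` -/

/-- **LOWER TANGENT BOUND `s E_q k ≤ log Z(q') − log Z(q)`** (Jensen; `κ ↦ log Z(p, e^κ)` is convex).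
[cite: Grimmett2006, §4.5 Thm. (4.58), (4.83)] -/
theorem mul_rcExpect_clusterCount_le_sub {p q q' : ℝ} (hp : p ∈ Set.Ioo (0 : ℝ) 1) (hq : 0 < q) (hq' : 0 < q') (B : Set V) :
    Real.log (q' / q) * rcExpect G p q B (fun ω => (clusterCount (↑ω : BondConfig V) B : ℝ)) ≤
      Real.log (rcPartitionFunction G p q' B) - Real.log (rcPartitionFunction G p q B) := by
  have h := log_rcPartitionFunction_sub_ge₂ G hp hp hq hq' B
  rw [div_self hp.1.ne', div_self (sub_pos.2 hp.2).ne', Real.log_one, zero_mul, zero_mul, zero_add, zero_add] at h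
  exact h

/-- **UPPER TANGENT BOUND `log Z(q') − log Z(q) ≤ s E_{q'} k`** (the lower tangent bound at `q'` towards `q`).
[cite: Grimmett2006, §4.5 Thm. (4.58), (4.83)] -/
theorem sub_le_mul_rcExpect_clusterCount {p q q' : ℝ} (hp : p ∈ Set.Ioo (0 : ℝ) 1) (hq : 0 < q) (hq' : 0 < q') (B : Set V) :
    Real.log (rcPartitionFunction G p q' B) - Real.log (rcPartitionFunction G p q B) ≤
      Real.log (q' / q) * rcExpect G p q' B (fun ω => (clusterCount (↑ω : BondConfig V) B : ℝ)) := by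
  have h := mul_rcExpect_clusterCount_le_sub G hp hq' hq B
  have hlog : Real.log (q / q') = -Real.log (q' / q) := by
    rw [← Real.log_inv, inv_div]
  rw [hlog] at h
  linarith

/-! ### Chernoff bounds -/

/-- **CHERNOFF UPPER-TAIL BOUND FOR THE CLUSTER COUNT**: for `0 < q ≤ q'` (so `s = log(q'/q) ≥ 0`) and every real `a`,
`φ^B_{G,p,q}{a ≤ k^B} ≤ exp(−(sa − (log Z(q') − log Z(q))))`. [cite: Ellis2006, Thm. II.6.1 (b) (proof); Grimmett2006, Thm. (4.58)] -/
theorem rcExpect_indicator_le_clusterCount_le {p q q' : ℝ} (hp : p ∈ Set.Ioo (0 : ℝ) 1) (hq : 0 < q) (hqq' : q ≤ q') (B : Set V)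
    (a : ℝ) :
    rcExpect G p q B (fun ω => if a ≤ (clusterCount (↑ω : BondConfig V) B : ℝ) then 1 else 0) ≤
      Real.exp (-(Real.log (q' / q) * a - (Real.log (rcPartitionFunction G p q' B) - Real.log (rcPartitionFunction G p q B)))) := by
  have hpI : p ∈ Set.Icc (0 : ℝ) 1 := ⟨hp.1.le, hp.2.le⟩
  have hq' : 0 < q' := hq.trans_le hqq'
  set t : ℝ := Real.log (q' / q) with ht
  have ht0 : 0 ≤ t := Real.log_nonneg ((one_le_div hq).2 hqq')
  -- Markov: `1{a ≤ k} ≤ e^{t(k − a)}`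
  have hmono : rcExpect G p q B (fun ω => if a ≤ (clusterCount (↑ω : BondConfig V) B : ℝ) then 1 else 0) ≤
      rcExpect G p q B (fun ω => Real.exp (-(t * a)) * Real.exp (t * clusterCount (↑ω : BondConfig V) B)) := by
    refine rcExpect_mono G hpI hq B fun ω _ => ?_
    split_ifs with h
    · rw [← Real.exp_add]
      have : 0 ≤ -(t * a) + t * clusterCount (↑ω : BondConfig V) B := by nlinarith
      linarith [Real.add_one_le_exp (-(t * a) + t * clusterCount (↑ω : BondConfig V) B)]
    · positivity
  have hpos : 0 < rcExpect G p q B (fun ω => Real.exp (t * clusterCount (↑ω : BondConfig V) B)) := by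
    rw [ht, rcExpect_exp_mul_clusterCount G hp hq hq' B]
    exact div_pos (rcPartitionFunction_pos G hpI hq' B) (rcPartitionFunction_pos G hpI hq B)
  calc rcExpect G p q B (fun ω => if a ≤ (clusterCount (↑ω : BondConfig V) B : ℝ) then 1 else 0)
      ≤ Real.exp (-(t * a)) * rcExpect G p q B (fun ω => Real.exp (t * clusterCount (↑ω : BondConfig V) B)) := by
        rwa [← rcExpect_const_mul]
    _ = Real.exp (-(t * a - (Real.log (rcPartitionFunction G p q' B) - Real.log (rcPartitionFunction G p q B)))) := by
        rw [← Real.exp_log hpos, ← Real.exp_add, ht, log_rcExpect_exp_mul_clusterCount G hp hq hq' B]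
        congr 1
        ring

/-- **CHERNOFF LOWER-TAIL BOUND FOR THE CLUSTER COUNT**: for `0 < q' ≤ q` (so `s ≤ 0`) and every real `a`,
`φ^B_{G,p,q}{k^B ≤ a} ≤ exp(−(sa − (log Z(q') − log Z(q))))`. [cite: Ellis2006, Thm. II.6.1 (b) (proof); Grimmett2006, Thm. (4.58)] -/
theorem rcExpect_indicator_clusterCount_le_le {p q q' : ℝ} (hp : p ∈ Set.Ioo (0 : ℝ) 1) (hq' : 0 < q') (hqq' : q' ≤ q)
    (B : Set V) (a : ℝ) :
    rcExpect G p q B (fun ω => if (clusterCount (↑ω : BondConfig V) B : ℝ) ≤ a then 1 else 0) ≤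
      Real.exp (-(Real.log (q' / q) * a - (Real.log (rcPartitionFunction G p q' B) - Real.log (rcPartitionFunction G p q B)))) := by
  have hpI : p ∈ Set.Icc (0 : ℝ) 1 := ⟨hp.1.le, hp.2.le⟩
  have hq : 0 < q := hq'.trans_le hqq'
  set t : ℝ := Real.log (q' / q) with ht
  have ht0 : t ≤ 0 := Real.log_nonpos (div_pos hq' hq).le ((div_le_one hq).2 hqq')
  have hmono : rcExpect G p q B (fun ω => if (clusterCount (↑ω : BondConfig V) B : ℝ) ≤ a then 1 else 0) ≤
      rcExpect G p q B (fun ω => Real.exp (-(t * a)) * Real.exp (t * clusterCount (↑ω : BondConfig V) B)) := by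
    refine rcExpect_mono G hpI hq B fun ω _ => ?_
    split_ifs with h
    · rw [← Real.exp_add]
      have : 0 ≤ -(t * a) + t * clusterCount (↑ω : BondConfig V) B := by nlinarith
      linarith [Real.add_one_le_exp (-(t * a) + t * clusterCount (↑ω : BondConfig V) B)]
    · positivity
  have hpos : 0 < rcExpect G p q B (fun ω => Real.exp (t * clusterCount (↑ω : BondConfig V) B)) := by
    rw [ht, rcExpect_exp_mul_clusterCount G hp hq hq' B]
    exact div_pos (rcPartitionFunction_pos G hpI hq' B) (rcPartitionFunction_pos G hpI hq B)
  calc rcExpect G p q B (fun ω => if (clusterCount (↑ω : BondConfig V) B : ℝ) ≤ a then 1 else 0)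
      ≤ Real.exp (-(t * a)) * rcExpect G p q B (fun ω => Real.exp (t * clusterCount (↑ω : BondConfig V) B)) := by
        rwa [← rcExpect_const_mul]
    _ = Real.exp (-(t * a - (Real.log (rcPartitionFunction G p q' B) - Real.log (rcPartitionFunction G p q B)))) := by
        rw [← Real.exp_log hpos, ← Real.exp_add, ht, log_rcExpect_exp_mul_clusterCount G hp hq hq' B]
        congr 1
        ring

/-- **CHERNOFF UPPER-TAIL BOUND, MEAN FORM**: for `q ≤ q'`, `φ_q{a ≤ k} ≤ exp(−s(a − E_{q'} k))`.
[cite: Ellis2006, Thm. II.6.1 (b); Grimmett2006, Thm. (4.58)] -/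
theorem rcExpect_indicator_le_clusterCount_le_mean {p q q' : ℝ} (hp : p ∈ Set.Ioo (0 : ℝ) 1) (hq : 0 < q) (hqq' : q ≤ q')
    (B : Set V) (a : ℝ) :
    rcExpect G p q B (fun ω => if a ≤ (clusterCount (↑ω : BondConfig V) B : ℝ) then 1 else 0) ≤
      Real.exp (-(Real.log (q' / q) *
        (a - rcExpect G p q' B (fun ω => (clusterCount (↑ω : BondConfig V) B : ℝ))))) := by
  refine (rcExpect_indicator_le_clusterCount_le G hp hq hqq' B a).trans ?_
  rw [Real.exp_le_exp]
  have := sub_le_mul_rcExpect_clusterCount G hp hq (hq.trans_le hqq') B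
  nlinarith

/-- **CHERNOFF LOWER-TAIL BOUND, MEAN FORM**: for `q' ≤ q`, `φ_q{k ≤ a} ≤ exp(−s(a − E_{q'} k))` (`s ≤ 0`).
[cite: Ellis2006, Thm. II.6.1 (b); Grimmett2006, Thm. (4.58)] -/
theorem rcExpect_indicator_clusterCount_le_le_mean {p q q' : ℝ} (hp : p ∈ Set.Ioo (0 : ℝ) 1) (hq' : 0 < q') (hqq' : q' ≤ q)
    (B : Set V) (a : ℝ) :
    rcExpect G p q B (fun ω => if (clusterCount (↑ω : BondConfig V) B : ℝ) ≤ a then 1 else 0) ≤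
      Real.exp (-(Real.log (q' / q) *
        (a - rcExpect G p q' B (fun ω => (clusterCount (↑ω : BondConfig V) B : ℝ))))) := by
  refine (rcExpect_indicator_clusterCount_le_le G hp hq' hqq' B a).trans ?_
  rw [Real.exp_le_exp]
  have := sub_le_mul_rcExpect_clusterCount G hp (hq'.trans_le hqq') hq' B
  nlinarith

/-! ### Measure forms -/

/-- The event `{a ≤ k^B}` under `φ^B_{G,p,q}` as the expectation of an indicator. [cite: Grimmett2006, §1.2 eq. (1.2)] -/
theorem rcMeasure_real_clusterCount_ge_eq {p q : ℝ} (hp : p ∈ Set.Icc (0 : ℝ) 1) (hq : 0 < q) (B : Set V) (a : ℝ) :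
    (rcMeasure G p q B).real {η : BondConfig V | a ≤ (clusterCount η B : ℝ)} =
      rcExpect G p q B (fun ω => if a ≤ (clusterCount (↑ω : BondConfig V) B : ℝ) then 1 else 0) := by
  classical
  rw [rcMeasure_real_eq_rcExpect G hp hq B]
  refine rcExpect_congr G p q B fun ω _ => ?_
  simp only [Set.mem_setOf_eq]

/-- The event `{k^B ≤ a}` under `φ^B_{G,p,q}` as the expectation of an indicator. [cite: Grimmett2006, §1.2 eq. (1.2)] -/
theorem rcMeasure_real_clusterCount_le_eq {p q : ℝ} (hp : p ∈ Set.Icc (0 : ℝ) 1) (hq : 0 < q) (B : Set V) (a : ℝ) :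
    (rcMeasure G p q B).real {η : BondConfig V | (clusterCount η B : ℝ) ≤ a} =
      rcExpect G p q B (fun ω => if (clusterCount (↑ω : BondConfig V) B : ℝ) ≤ a then 1 else 0) := by
  classical
  rw [rcMeasure_real_eq_rcExpect G hp hq B]
  refine rcExpect_congr G p q B fun ω _ => ?_
  simp only [Set.mem_setOf_eq]

/-- **CHERNOFF UPPER TAIL, measure form**: `φ^B_{G,p,q}{a ≤ k^B} ≤ exp(−(sa − (log Z(q') − log Z(q))))` for `0 < q ≤ q'`.
[cite: Ellis2006, Thm. II.6.1 (b); Grimmett2006, Thm. (4.58)] -/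
theorem rcMeasure_real_le_clusterCount_le {p q q' : ℝ} (hp : p ∈ Set.Ioo (0 : ℝ) 1) (hq : 0 < q) (hqq' : q ≤ q') (B : Set V)
    (a : ℝ) :
    (rcMeasure G p q B).real {η : BondConfig V | a ≤ (clusterCount η B : ℝ)} ≤
      Real.exp (-(Real.log (q' / q) * a - (Real.log (rcPartitionFunction G p q' B) - Real.log (rcPartitionFunction G p q B)))) := by
  rw [rcMeasure_real_clusterCount_ge_eq G ⟨hp.1.le, hp.2.le⟩ hq B a]
  exact rcExpect_indicator_le_clusterCount_le G hp hq hqq' B a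

/-- **CHERNOFF LOWER TAIL, measure form**: `φ^B_{G,p,q}{k^B ≤ a} ≤ exp(−(sa − (log Z(q') − log Z(q))))` for `0 < q' ≤ q`.
[cite: Ellis2006, Thm. II.6.1 (b); Grimmett2006, Thm. (4.58)] -/
theorem rcMeasure_real_clusterCount_le_le {p q q' : ℝ} (hp : p ∈ Set.Ioo (0 : ℝ) 1) (hq' : 0 < q') (hqq' : q' ≤ q) (B : Set V)
    (a : ℝ) :
    (rcMeasure G p q B).real {η : BondConfig V | (clusterCount η B : ℝ) ≤ a} ≤
      Real.exp (-(Real.log (q' / q) * a - (Real.log (rcPartitionFunction G p q' B) - Real.log (rcPartitionFunction G p q B)))) := by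
  rw [rcMeasure_real_clusterCount_le_eq G ⟨hp.1.le, hp.2.le⟩ (hq'.trans_le hqq') B a]
  exact rcExpect_indicator_clusterCount_le_le G hp hq' hqq' B a

end RandomClusterLargeDeviations

end Summit.CriticalPhenomena.PercolationContinuityZ3.Theorems.FK
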